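import Literature.InformationTheory.Entanglement.MajorizationCriterion
import Literature.InformationTheory.Entanglement.NielsenTheoremSeparable
import Literature.LinearAlgebra.Matrix.PosSemidefBlockCompressions
import HarnessLib

/-!
# The reduction criterion implies the majorization criterion (Hiroshima 2003, Theorem 1):
# `ρ_A ⊗ I ≥ ρ_{AB} ⟹ λ(ρ_{AB}) ≺ λ(ρ_A)`

Hodge foundations lane (`lit-hodgefound`, prover p24 gen 77; quantum-information series, sequel of
`MajorizationCriterion.lean` (Nielsen–Kempe: B&Ż § 16.6 B4/B5) — this file supplies B3 ⟹ B4).  THEOREMS ONLY: no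
definition, no named fact, net debt 0.

## Source, VERBATIM — T. Hiroshima, *Majorization criterion for distillability of a bipartite quantum state*,
Phys. Rev. Lett. **91** (2003) 057902 [Hiroshima2003] (held `paper:arxiv-quant-ph_0303057`, chunks p0002–p0004)

«The reduction criterion asserts that if a bipartite quantum state `ρ_{AB}` on a composite Hilbert space
`ℋ_A ⊗ ℋ_B` is undistillable, then the following operator inequalities are satisfied: `ρ_A ⊗ I_B ≥ ρ_{AB}`, (1) and
`I_A ⊗ ρ_B ≥ ρ_{AB}`, (2) where `ρ_{A(B)} = Tr_{B(A)} ρ_{AB}` … If the dimensions of `x` and `y` are different, the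
smaller vector is enlarged by appending extra zeros to equalize their dimensions. … Now a question arises: in which
ways are these two (reduction and majorization) criteria related? It has been conjectured that the majorization
criterion is implied by the reduction crierion, but this has not been proven [Bruss, Terhal, VW]. In this paper, I prove
that this conjecture is true. … **Theorem 1:** If `ρ_{AB}` is a density matrix such that `ρ_A ⊗ I_B ≥ ρ_{AB}`, then
`λ(ρ_{AB}) ≺ λ(ρ_A)`.»
«*Proof of Theorem 1:* By virtue of Lemma 2, we can assume that `ρ_A` is invertible without loss of generality.
Therefore, by Lemma 1, Eq. (1) implies the existence of an operator `R` such that `ρ_{AB}^{1/2} = (ρ_A^{1/2} ⊗ I_B) R`,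
with `‖R‖_∞ ≤ 1`. … `diag √λ(ρ_{AB}) = V^†(ρ_A^{1/2} ⊗ I_B) C`, where `C = RV`, and it is also a contraction … Now, from
Eq. (…) we have `ρ_{AB} = (ρ_A^{1/2} ⊗ I_B) CC^†(ρ_A^{1/2} ⊗ I_B)`, and `diag λ(ρ_{AB}) = C^†(ρ_A ⊗ I_B) C`. …
`λ_{[i,j]}(ρ_{AB}) = Σ_{k,l} λ_k(ρ_A) |C_{[k,l],[i,j]}|²`. Namely, `(λ_1(ρ_{AB}), …)^t = S (λ_1(ρ_A), …)^t`. Here, the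
matrix `S` is defined as `S_{i,j} = Σ_k |C_{[j,k],i}|² ≥ 0`. The row sum … `Σ_j S_{ij} ≤ 1`. … The column sum …
`Σ_i S_{ij} … = 1`. … `S` is doubly substochastic. Hence `(λ_1(ρ_{AB}), …, λ_{d_A}(ρ_{AB})) ≺_w (λ_1(ρ_A), …, λ_{d_A}(ρ_A))`.
Since `λ_i(ρ_{AB})` (`1 ≤ i ≤ d_A`) are the first `d_A` largest eigenvalues of `ρ_{AB}`, we can conclude that
`Σ_{i=1}^k λ_i(ρ_{AB}) ≤ Σ_{i=1}^k λ_i(ρ_A)` (`1 ≤ k ≤ d_Ad_B`) with the inequality holding equality for `k = d_Ad_B` due to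
the obvious fact that `Tr_{AB} ρ_{AB} = Tr_A ρ_A = 1`. □»
«Theorem 1 is also connected with the distillability problem. … **Theorem 2:** If `ρ_{AB}` is not distillable, then
`λ(ρ_{AB}) ≺ λ(ρ_A)` and `λ(ρ_{AB}) ≺ λ(ρ_B)`.» (Theorem 2 = Theorem 1 + the reduction criterion for undistillable
states [HH99]; distillability is not in the tree, so only Theorem 1 and its mirror are formalized.)

## Dictionary (no definitions introduced)

* `ρ = ρ_{AB} : Matrix (m × n) (m × n) ℂ`, `ρ_A = traceRight ρ`, `ρ_B = traceLeft ρ` (tree `QuantumMarginals`); the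
  hypothesis (1) is `(traceRight ρ ⊗ₖ 1 − ρ).PosSemidef` (= `(PPT.redB ρ).PosSemidef` of the lane's
  `WernerStateSeparability.lean`, see `sum_singularValues_le_traceRight_of_redB`).
* `λ(·)` zero-padded and sorted = Mathlib's `(toEuclideanLin ·).singularValues` (as in `MajorizationCriterion.lean`), so
  the conclusion `λ(ρ_{AB}) ≺ λ(ρ_A)` is `∀ k, Σ_{j<k} σ_j(ρ) ≤ Σ_{j<k} σ_j(ρ_A)` (the equality clause at `k = d_Ad_B` is the
  «obvious fact» `Tr ρ = Tr ρ_A`, recorded separately).  We prove it for every positive semidefinite `ρ` satisfying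
  (1); the printed `Tr ρ = 1` is not used.

## Proof route (the printed mechanism, with an `ε`-regularisation in place of Lemma 2)

Instead of restricting to `Ker(ρ_A)^⊥` (Lemma 2) we replace `ρ_A` by `ρ_A + εI` (`ε > 0`), which is invertible and
still satisfies `(ρ_A + εI) ⊗ I ≥ ρ`.  With `R_ε = (ρ_A + εI)^{-1/2} ⊗ I` the contraction of Lemma 1 is
`K = R_ε ρ R_ε` (`0 ≤ K ≤ I`), `ρ = R_ε^{-1} K R_ε^{-1}`, and `λ(ρ) = λ(√K ((ρ_A+εI) ⊗ I) √K)` (`XX^*` vs `X^*X`).  For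
the spectral projection `Π` onto the `k` largest eigenvalues of the latter, `Σ_{i≤k} λ_i(ρ) = Tr(G ((ρ_A+εI) ⊗ I))`
with `G = √K Π √K`, `0 ≤ G ≤ K`; in the eigenbasis `u_a` of `ρ_A` this is `Σ_a (μ_a + ε) T_a`, `T_a = Tr(G (u_au_a^* ⊗ I))`,
and the printed doubly-substochastic constraints become `0 ≤ T_a ≤ Tr(K(u_au_a^* ⊗ I)) = μ_a/(μ_a+ε) ≤ 1` (column sums,
from `Tr_B ρ = ρ_A`) and `Σ_a T_a = Tr(ΠK) ≤ k` (row sums, from `K ≤ I`).  The greedy step («the first `d_A` largest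
eigenvalues», weak majorization by a doubly substochastic matrix) gives `Σ_a μ_a T_a ≤ Σ_{i≤k} λ↓_i(ρ_A)`, whence
`Σ_{i≤k} λ_i(ρ) ≤ Σ_{i≤k} λ_i(ρ_A) + kε` for every `ε > 0`.

## What is formalized (all PROVED)

* § 1 `sum_mul_le_sum_filter_of_sum_le` (the greedy / doubly-substochastic step), `trace_proj_mul_nonneg`
  (`Tr(ΠX) ≥ 0` for a projection `Π` and `X ⪰ 0`).
* § 2 **Theorem 1** `sum_singularValues_le_traceRight_of_reduction` (`ρ ⪰ 0`, `ρ_A ⊗ I − ρ ⪰ 0 ⟹ λ(ρ) ≺_w λ(ρ_A)`,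
  padded prefix sums), the `redB` spelling `sum_singularValues_le_traceRight_of_redB`, and the equality clause
  `sum_singularValues_eq_sum_singularValues_traceRight` («`Tr ρ_{AB} = Tr ρ_A`»).
* § 3 consequences through `MajorizationCriterion.lean`: the entropy inequalities `S(ρ_A) ≤ S(ρ)`,
  `S_q(ρ_A) ≤ S_q(ρ)` (`q ≥ 0`) for states satisfying the reduction criterion
  (`vonNeumannEntropy_traceRight_le_of_reduction`, `renyiEntropy_traceRight_le_of_reduction`).

NOT formalized: the second marginal `λ(ρ_{AB}) ≺ λ(ρ_B)` under (2) (the mirror statement; `-- TODO(general form)`),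
Lemma 1 (Douglas) and Lemma 2 as separate statements, Theorem 2 (distillability).

## Tree / Mathlib search (2026-08-31)

`rg -il "Hiroshima|reduction criterion.*majori" Literature` → ∅ (the lane's `WernerStateSeparability.lean` has the
reduction MAP and criterion B3, `PPT.redB`, `PPT.posSemidef_trace_smul_one_sub`).  REUSED: `MajorizationCriterion.
{singularValues_mul_conjTranspose_comm, vonNeumannEntropy_le_of_majorized, renyiEntropy_le_of_majorized,
sum_singularValues_eq_one_of_card_le}`, `NielsenSeparable.{frameProj_conjTranspose, frameProj_mul_self, trace_frameProj,
trace_frameProj_mul_frameDiag, one_sub_frameProj}`, `PositiveMapKadisonChoiInequalities.{sum_smul_vecMulVec_col_eq,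
sum_vecMulVec_col_eq_one}`, `PosSemidefBlockCompressions.posSemidef_traceRight`, `QuantumMarginals.trace_mul_traceRight`,
`Literature.LinearAlgebra.Matrix.sum_singularValues_eq_sum_eigenvalues₀_of_posSemidef`; Mathlib `CFC.sqrt`,
`IsHermitian.spectral_theorem`, `Matrix.mul_kronecker_mul`.

## References

* [Hiroshima2003] T. Hiroshima, Phys. Rev. Lett. 91 (2003) 057902 (arXiv:quant-ph/0303057), Theorem 1 with Lemmas 1–2
  and proof, Theorem 2 (chunks p0002–p0004).
* [NielsenKempe2001] M. A. Nielsen, J. Kempe, Phys. Rev. Lett. 86 (2001) 5184 (the majorization criterion).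
* [BengtssonZyczkowski2017] I. Bengtsson, K. Życzkowski, *Geometry of Quantum States*, § 16.6 B3, B4.
-/

noncomputable section

open Matrix Finset
open scoped ComplexOrder MatrixOrder Kronecker ComplexConjugate

namespace Literature.InformationTheory.Entanglement.ReductionCriterionMajorization

open Literature.InformationTheory.Entanglement.PPT (IsSeparable redB trB)
open Literature.InformationTheory.Entanglement.MajorizationCriterion (singularValues_mul_conjTranspose_comm
  vonNeumannEntropy_le_of_majorized renyiEntropy_le_of_majorized)
open Literature.InformationTheory.Entanglement.NielsenSeparable (frameProj_conjTranspose frameProj_mul_self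
  trace_frameProj trace_frameProj_mul_frameDiag one_sub_frameProj)
open Literature.Computability.QuantumComplexity (traceRight traceLeft traceRight_apply trace_traceRight
  trace_mul_traceRight)
open Literature.LinearAlgebra.Matrix (sum_singularValues_eq_sum_eigenvalues₀_of_posSemidef
  singularValues_toEuclideanLin_of_card_le)
open Literature.LinearAlgebra.Matrix.PosSemidefBlockCompressions (posSemidef_traceRight)
open Literature.LinearAlgebra.Matrix.PositiveMapKadisonChoiInequalities (sum_smul_vecMulVec_col_eq
  sum_vecMulVec_col_eq_one)
open Literature.InformationTheory.Entropy (vonNeumannEntropy renyiEntropy)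

/-! ## § 1. The greedy (doubly substochastic) step and a trace positivity helper -/

section Helpers

/-- Bookkeeping: a sum over `{i : Fin N | i < ℓ}` of an `ℕ`-indexed family is the sum over `range (min ℓ N)`.
[folklore] -/
private theorem sum_filter_lt_eq_sum_range_min (f : ℕ → ℝ) (N ℓ : ℕ) :
    ∑ i ∈ univ.filter (fun i : Fin N => (i : ℕ) < ℓ), f i = ∑ j ∈ range (min ℓ N), f j := by
  rw [Finset.sum_filter, Fin.sum_univ_eq_sum_range (fun j => if j < ℓ then f j else 0) N, ← Finset.sum_filter]
  congr 1
  ext j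
  simp only [mem_filter, mem_range, lt_min_iff, and_comm]

/-- Bookkeeping: `|{i : Fin N | i < ℓ}| = min ℓ N`. [folklore] -/
private theorem card_filter_lt (N ℓ : ℕ) : ((univ.filter (fun i : Fin N => (i : ℕ) < ℓ)).card : ℝ) = min ℓ N := by
  have h := sum_filter_lt_eq_sum_range_min (fun _ => (1 : ℝ)) N ℓ
  rw [sum_const, sum_const, card_range, nsmul_eq_mul, nsmul_eq_mul, mul_one, mul_one] at h
  exact h

/-- **The greedy step behind «`S` is doubly substochastic ⟹ `λ(ρ_{AB}) ≺_w λ(ρ_A)`»**: for a decreasing nonnegative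
`μ` and weights `0 ≤ q_j ≤ 1` of total mass at most `k`, `Σ_j μ_j q_j ≤ μ_1 + ⋯ + μ_k`.
[cite: Hiroshima2003, proof of Thm 1 (the doubly substochastic `S`, eqs. for the row and column sums)]
[cite: HornJohnson2013, § 4.3 (4.3.40)–(4.3.46)] -/
theorem sum_mul_le_sum_filter_of_sum_le {N : ℕ} (μ q : Fin N → ℝ) (hμ : Antitone μ) (hμ0 : ∀ j, 0 ≤ μ j)
    (hq0 : ∀ j, 0 ≤ q j) (hq1 : ∀ j, q j ≤ 1) {k : ℕ} (hsum : ∑ j, q j ≤ k) :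
    ∑ j, μ j * q j ≤ ∑ j ∈ univ.filter (fun j : Fin N => (j : ℕ) < k), μ j := by
  set S := univ.filter (fun j : Fin N => (j : ℕ) < k) with hS
  by_cases hk : N ≤ k
  · -- every index is below `k`: `Σ μ q ≤ Σ μ`
    have hSu : S = univ := by
      ext j; simp only [hS, mem_filter, mem_univ, true_and, iff_true]; exact lt_of_lt_of_le j.2 hk
    rw [hSu]
    exact sum_le_sum fun j _ => by nlinarith [hμ0 j, hq1 j, hq0 j]
  · push Not at hk
    set jk : Fin N := ⟨k, hk⟩ with hjk
    have hsplit := (Finset.sum_filter_add_sum_filter_not univ (fun j : Fin N => (j : ℕ) < k) (fun j => μ j * q j)).symm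
    rw [hsplit]
    -- the tail: `Σ_{j ≥ k} μ_j q_j ≤ μ_k Σ_{j ≥ k} q_j`
    have htail : ∑ j ∈ univ.filter (fun j : Fin N => ¬ (j : ℕ) < k), μ j * q j ≤
        μ jk * ∑ j ∈ univ.filter (fun j : Fin N => ¬ (j : ℕ) < k), q j := by
      rw [Finset.mul_sum]
      refine sum_le_sum fun j hj => ?_
      rw [mem_filter] at hj
      exact mul_le_mul_of_nonneg_right (hμ (Fin.le_def.2 (by rw [hjk]; exact not_lt.1 hj.2))) (hq0 j)
    -- the mass outside `S` is at most the slack inside `S`: `Σ_{j≥k} q_j ≤ Σ_{j<k} (1 − q_j)`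
    have hcardS : (S.card : ℝ) = k := by rw [hS, card_filter_lt, min_eq_left hk.le]
    have hmass : ∑ j ∈ univ.filter (fun j : Fin N => ¬ (j : ℕ) < k), q j ≤ ∑ j ∈ S, (1 - q j) := by
      have h := Finset.sum_filter_add_sum_filter_not univ (fun j : Fin N => (j : ℕ) < k) q
      rw [sum_sub_distrib, sum_const, nsmul_eq_mul, mul_one, hcardS]
      linarith
    -- on `S`, `μ_k ≤ μ_j`
    have hhead : μ jk * ∑ j ∈ S, (1 - q j) ≤ ∑ j ∈ S, μ j * (1 - q j) := by
      rw [Finset.mul_sum]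
      refine sum_le_sum fun j hj => ?_
      rw [hS, mem_filter] at hj
      exact mul_le_mul_of_nonneg_right (hμ (Fin.le_def.2 (by rw [hjk]; exact hj.2.le))) (sub_nonneg.2 (hq1 j))
    calc ∑ j ∈ S, μ j * q j + ∑ j ∈ univ.filter (fun j : Fin N => ¬ (j : ℕ) < k), μ j * q j
        ≤ ∑ j ∈ S, μ j * q j + μ jk * ∑ j ∈ S, (1 - q j) :=
          add_le_add le_rfl (htail.trans (mul_le_mul_of_nonneg_left hmass (hμ0 jk)))
      _ ≤ ∑ j ∈ S, μ j * q j + ∑ j ∈ S, μ j * (1 - q j) := add_le_add le_rfl hhead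
      _ = ∑ j ∈ S, μ j := by rw [← sum_add_distrib]; exact sum_congr rfl fun j _ => by ring

variable {q : Type*} [Fintype q] [DecidableEq q]

omit [DecidableEq q] in
/-- `Tr(Π X) ≥ 0` for an orthogonal projection `Π` and `X ⪰ 0` (`Tr(ΠX) = Tr(ΠXΠ^*)`).
[cite: Hiroshima2003, proof of Thm 1 («the diagonal elements of a hermitian matrix do not exceed its maximum
eigenvalue», the positivity `S_{ij} ≥ 0`)] -/
theorem trace_proj_mul_nonneg {Pj X : Matrix q q ℂ} (hPjh : Pjᴴ = Pj) (hPjPj : Pj * Pj = Pj) (hX : X.PosSemidef) :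
    (0 : ℂ) ≤ (Pj * X).trace := by
  have h : (Pj * X).trace = (Pj * X * Pjᴴ).trace := by
    rw [hPjh, trace_mul_cycle, hPjPj]
  rw [h]
  exact (hX.mul_mul_conjTranspose_same Pj).trace_nonneg

omit [DecidableEq q] in
/-- `Tr(Π X) ≤ Tr(Π Y)` for an orthogonal projection `Π` when `Y − X ⪰ 0`. [cite: Hiroshima2003, proof of Thm 1
(monotonicity steps `S_{ij} ≤ …`)] -/
theorem re_trace_proj_mul_le {Pj X Y : Matrix q q ℂ} (hPjh : Pjᴴ = Pj) (hPjPj : Pj * Pj = Pj) (hXY : (Y - X).PosSemidef) :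
    ((Pj * X).trace).re ≤ ((Pj * Y).trace).re := by
  have h := trace_proj_mul_nonneg hPjh hPjPj hXY
  rw [Matrix.mul_sub, trace_sub] at h
  have h2 := (Complex.nonneg_iff.1 h).1
  rw [Complex.sub_re] at h2
  linarith

end Helpers

/-! ## § 2. Theorem 1: `ρ_A ⊗ I ≥ ρ ⟹ λ(ρ) ≺ λ(ρ_A)` -/

section Theorem1

variable {m n : Type*} [Fintype m] [Fintype n] [DecidableEq m] [DecidableEq n]

/-- **Theorem 1 (Hiroshima 2003): the reduction criterion implies the majorization criterion.**  If `ρ ⪰ 0` on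
`ℂ^m ⊗ ℂ^n` satisfies `ρ_A ⊗ I_B − ρ ⪰ 0`, then `Σ_{j<k} λ↓_j(ρ) ≤ Σ_{j<k} λ↓_j(ρ_A)` for every `k` (zero-padded
decreasing spectra, i.e. `λ(ρ) ≺_w λ(ρ_A)`; with `Tr ρ = Tr ρ_A` this is `λ(ρ) ≺ λ(ρ_A)`).
[cite: Hiroshima2003, Thm 1 with proof (Lemmas 1–2, the doubly substochastic `S`)] -/
theorem sum_singularValues_le_traceRight_of_reduction {ρ : Matrix (m × n) (m × n) ℂ} (hρ : ρ.PosSemidef)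
    (hred : (traceRight ρ ⊗ₖ (1 : Matrix n n ℂ) - ρ).PosSemidef) (k : ℕ) :
    ∑ j ∈ range k, (Matrix.toEuclideanLin ρ).singularValues j ≤
      ∑ j ∈ range k, (Matrix.toEuclideanLin (traceRight ρ)).singularValues j := by
  classical
  -- eigen-data of `ρ_A`
  set A : Matrix m m ℂ := traceRight ρ with hAdef
  have hA : A.PosSemidef := posSemidef_traceRight hρ
  set μ : m → ℝ := hA.isHermitian.eigenvalues with hμ
  have hμ0 : ∀ a, 0 ≤ μ a := fun a => hA.eigenvalues_nonneg a
  set U : Matrix m m ℂ := (hA.isHermitian.eigenvectorUnitary : Matrix m m ℂ) with hU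
  have hUmem : U ∈ Matrix.unitaryGroup m ℂ := hA.isHermitian.eigenvectorUnitary.2
  have hAU : A = U * diagonal (fun a => ((μ a : ℝ) : ℂ)) * Uᴴ := by
    rw [← star_eq_conjTranspose]; exact hA.isHermitian.spectral_theorem
  -- the eigenprojections `E_a = u_au_a^*`
  set E : m → Matrix m m ℂ := fun a => vecMulVec (fun x => U x a) (star fun x => U x a) with hE
  have hE1 : ∑ a, E a = 1 := sum_vecMulVec_col_eq_one hUmem
  have hAE : A = ∑ a, ((μ a : ℝ) : ℂ) • E a := by rw [hAU, ← sum_smul_vecMulVec_col_eq]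
  have hUU : Uᴴ * U = 1 := by rw [← star_eq_conjTranspose]; exact Matrix.mem_unitaryGroup_iff'.mp hUmem
  have hcol : ∀ a b, (star fun x => U x a) ⬝ᵥ (fun x => U x b) = if a = b then 1 else 0 := fun a b => by
    have h := congrFun (congrFun hUU a) b
    rw [Matrix.mul_apply, one_apply] at h
    rw [← h, dotProduct]
    exact sum_congr rfl fun x _ => by rw [Pi.star_apply, conjTranspose_apply]
  have hEE : ∀ a b, E a * E b = if a = b then E a else 0 := fun a b => by
    by_cases hab : a = b
    · subst hab
      simp only [hE, vecMulVec_mul_vecMulVec, hcol, if_true, one_smul]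
    · simp only [hE, vecMulVec_mul_vecMulVec, hcol, if_neg hab, zero_smul, vecMulVec_zero]
  have hEh : ∀ a, (E a)ᴴ = E a := fun a => by
    simp only [hE, conjTranspose_vecMulVec, star_star]
  have hEtr : ∀ a, (E a).trace = 1 := fun a => by
    simp only [hE, trace_vecMulVec]
    rw [dotProduct_comm, hcol, if_pos rfl]
  -- products of `Σ_a c_a E_a`
  have hmulE : ∀ c d : m → ℂ, (∑ a, c a • E a) * (∑ a, d a • E a) = ∑ a, (c a * d a) • E a := fun c d => by
    rw [Finset.sum_mul_sum]
    refine sum_congr rfl fun a _ => ?_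
    rw [Finset.sum_eq_single a]
    · rw [smul_mul_smul_comm, hEE, if_pos rfl]
    · intro b _ hba
      rw [smul_mul_smul_comm, hEE, if_neg (Ne.symm hba), smul_zero]
    · intro ha; exact absurd (mem_univ a) ha
  have hEmulSum : ∀ (c : m → ℂ) a, E a * (∑ b, c b • E b) = c a • E a := fun c a => by
    rw [Finset.mul_sum, Finset.sum_eq_single a]
    · rw [Matrix.mul_smul, hEE, if_pos rfl]
    · intro b _ hba; rw [Matrix.mul_smul, hEE, if_neg (Ne.symm hba), smul_zero]
    · intro ha; exact absurd (mem_univ a) ha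
  have hSummulE : ∀ (c : m → ℂ) a, (∑ b, c b • E b) * E a = c a • E a := fun c a => by
    rw [Finset.sum_mul, Finset.sum_eq_single a]
    · rw [Matrix.smul_mul, hEE, if_pos rfl]
    · intro b _ hba; rw [Matrix.smul_mul, hEE, if_neg hba, smul_zero]
    · intro ha; exact absurd (mem_univ a) ha
  have hconjE : ∀ c : m → ℝ, (∑ a, ((c a : ℝ) : ℂ) • E a)ᴴ = ∑ a, ((c a : ℝ) : ℂ) • E a := fun c => by
    rw [conjTranspose_sum]
    exact sum_congr rfl fun a _ => by rw [conjTranspose_smul, hEh, Complex.star_def, Complex.conj_ofReal]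
  -- `ε`-regularisation: it suffices to prove the bound up to `(k+1)ε`
  refine le_of_forall_pos_le_add fun δ hδ => ?_
  set ε : ℝ := δ / (k + 1) with hεdef
  have hε : 0 < ε := div_pos hδ (by positivity)
  have hkε : (k : ℝ) * ε ≤ δ := by
    rw [hεdef, mul_div_assoc']
    rw [div_le_iff₀ (by positivity : (0 : ℝ) < k + 1)]
    nlinarith
  -- the regularised square roots `P = (ρ_A + ε)^{1/2}`, `R = (ρ_A + ε)^{-1/2}`
  set p : m → ℝ := fun a => Real.sqrt (μ a + ε) with hp
  set r : m → ℝ := fun a => (Real.sqrt (μ a + ε))⁻¹ with hr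
  have hpos : ∀ a, 0 < μ a + ε := fun a => by linarith [hμ0 a]
  have hp_pos : ∀ a, 0 < p a := fun a => Real.sqrt_pos.2 (hpos a)
  have hpr : ∀ a, p a * r a = 1 := fun a => mul_inv_cancel₀ (hp_pos a).ne'
  have hpp : ∀ a, p a * p a = μ a + ε := fun a => Real.mul_self_sqrt (hpos a).le
  have hrr : ∀ a, r a * r a * (μ a + ε) = 1 := fun a => by
    rw [← hpp a]
    calc r a * r a * (p a * p a) = (p a * r a) * (p a * r a) := by ring
      _ = 1 := by rw [hpr, one_mul]
  set P : Matrix m m ℂ := ∑ a, ((p a : ℝ) : ℂ) • E a with hP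
  set R : Matrix m m ℂ := ∑ a, ((r a : ℝ) : ℂ) • E a with hR
  have hPR : P * R = 1 := by
    rw [hP, hR, hmulE, ← hE1]
    exact sum_congr rfl fun a _ => by rw [← Complex.ofReal_mul, hpr, Complex.ofReal_one, one_smul]
  have hRP : R * P = 1 := by
    rw [hP, hR, hmulE, ← hE1]
    exact sum_congr rfl fun a _ => by rw [← Complex.ofReal_mul, mul_comm, hpr, Complex.ofReal_one, one_smul]
  -- `A + εI = Σ_a (μ_a + ε) E_a = P²`
  have hAε : A + (ε : ℂ) • (1 : Matrix m m ℂ) = ∑ a, (((μ a + ε : ℝ)) : ℂ) • E a := by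
    rw [hAE, ← hE1, Finset.smul_sum, ← sum_add_distrib]
    exact sum_congr rfl fun a _ => by rw [← add_smul, Complex.ofReal_add]
  have hPP : P * P = A + (ε : ℂ) • 1 := by
    rw [hP, hmulE, hAε]
    exact sum_congr rfl fun a _ => by rw [← Complex.ofReal_mul, hpp]
  have hRAR : R * (A + (ε : ℂ) • 1) * R = 1 := by
    rw [hAε, hR, hmulE, hmulE, ← hE1]
    exact sum_congr rfl fun a _ => by
      rw [← Complex.ofReal_mul, ← Complex.ofReal_mul, mul_right_comm, hrr, Complex.ofReal_one, one_smul]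
  have hRER : ∀ a, R * E a * R = (((r a * r a : ℝ)) : ℂ) • E a := fun a => by
    rw [hR, hSummulE, Matrix.smul_mul, hEmulSum, smul_smul, ← Complex.ofReal_mul]
  have hRh : Rᴴ = R := hconjE r
  have hPh : Pᴴ = P := hconjE p
  -- tensoring with `I_B`
  set Rt : Matrix (m × n) (m × n) ℂ := R ⊗ₖ (1 : Matrix n n ℂ) with hRt
  set Pt : Matrix (m × n) (m × n) ℂ := P ⊗ₖ (1 : Matrix n n ℂ) with hPt
  set Bε : Matrix (m × n) (m × n) ℂ := (A + (ε : ℂ) • 1) ⊗ₖ (1 : Matrix n n ℂ) with hBε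
  have hPtRt : Pt * Rt = 1 := by rw [hPt, hRt, ← mul_kronecker_mul, hPR, Matrix.mul_one, one_kronecker_one]
  have hRtPt : Rt * Pt = 1 := by rw [hPt, hRt, ← mul_kronecker_mul, hRP, Matrix.mul_one, one_kronecker_one]
  have hPtPt : Pt * Pt = Bε := by rw [hPt, hBε, ← mul_kronecker_mul, hPP, Matrix.mul_one]
  have hRtBRt : Rt * Bε * Rt = 1 := by
    rw [hRt, hBε, ← mul_kronecker_mul, ← mul_kronecker_mul, hRAR, Matrix.mul_one, Matrix.mul_one, one_kronecker_one]
  have hRth : Rtᴴ = Rt := by rw [hRt, conjTranspose_kronecker, hRh, conjTranspose_one]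
  have hPth : Ptᴴ = Pt := by rw [hPt, conjTranspose_kronecker, hPh, conjTranspose_one]
  -- `B_ε − ρ ⪰ 0`
  have hBρ : (Bε - ρ).PosSemidef := by
    have e1 : Bε - ρ = (A ⊗ₖ (1 : Matrix n n ℂ) - ρ) + (ε : ℂ) • (1 : Matrix (m × n) (m × n) ℂ) := by
      rw [hBε, add_kronecker, smul_kronecker, one_kronecker_one]; abel
    rw [e1]
    exact hred.add (PosSemidef.one.smul (Complex.zero_le_real.2 hε.le))
  -- the contraction `K = R_ε ρ R_ε`: `0 ≤ K`, `I − K ⪰ 0`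
  set K : Matrix (m × n) (m × n) ℂ := Rt * ρ * Rt with hK
  have hKpsd : K.PosSemidef := by
    have h := hρ.mul_mul_conjTranspose_same Rt
    rwa [hRth] at h
  have hIK : (1 - K).PosSemidef := by
    have h := hBρ.mul_mul_conjTranspose_same Rt
    rwa [hRth, Matrix.mul_sub, Matrix.sub_mul, hRtBRt] at h
  -- its square root
  set Q : Matrix (m × n) (m × n) ℂ := CFC.sqrt K with hQ
  have hQpsd : Q.PosSemidef := nonneg_iff_posSemidef.mp (CFC.sqrt_nonneg K)
  have hQh : Qᴴ = Q := hQpsd.isHermitian.eq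
  have hQQ : Q * Q = K := CFC.sqrt_mul_sqrt_self K (nonneg_iff_posSemidef.mpr hKpsd)
  -- `ρ = XX^*` and `M = X^*X = √K B_ε √K` with `X = P_ε √K`
  set X : Matrix (m × n) (m × n) ℂ := Pt * Q with hX
  have hXX : X * Xᴴ = ρ := by
    rw [hX, conjTranspose_mul, hQh, hPth]
    simp only [Matrix.mul_assoc]
    rw [← Matrix.mul_assoc Q Q Pt, hQQ, hK]
    simp only [Matrix.mul_assoc]
    rw [hRtPt, Matrix.mul_one, ← Matrix.mul_assoc, hPtRt, Matrix.one_mul]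
  set M : Matrix (m × n) (m × n) ℂ := Q * Bε * Q with hM
  have hXhX : Xᴴ * X = M := by
    rw [hX, conjTranspose_mul, hQh, hPth]
    simp only [Matrix.mul_assoc]
    rw [← Matrix.mul_assoc Pt Pt Q, hPtPt, hM]
    simp only [Matrix.mul_assoc]
  have hBεpsd : Bε.PosSemidef := by
    rw [← hPtPt]
    have h := posSemidef_conjTranspose_mul_self Pt
    rwa [hPth] at h
  have hMpsd : M.PosSemidef := by
    have h := hBεpsd.mul_mul_conjTranspose_same Q
    rwa [hQh] at h
  -- `λ(ρ) = λ(M)`: `Σ_{j<k} σ_j(ρ) = Σ_{j<k} λ↓_j(M)`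
  have hσ : ∑ j ∈ range k, (Matrix.toEuclideanLin ρ).singularValues j =
      ∑ i ∈ univ.filter (fun i : Fin (Fintype.card (m × n)) => (i : ℕ) < k), hMpsd.isHermitian.eigenvalues₀ i := by
    rw [← sum_singularValues_eq_sum_eigenvalues₀_of_posSemidef hMpsd, ← hXhX, ← hXX]
    exact sum_congr rfl fun j _ => singularValues_mul_conjTranspose_comm X j
  rw [hσ]
  -- the spectral projection `Pk` of `M` onto its `k` largest eigenvalues
  set V : Matrix (m × n) (m × n) ℂ := (hMpsd.isHermitian.eigenvectorUnitary : Matrix (m × n) (m × n) ℂ) with hV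
  have hVmem : V ∈ Matrix.unitaryGroup (m × n) ℂ := hMpsd.isHermitian.eigenvectorUnitary.2
  set ν : m × n → ℝ := hMpsd.isHermitian.eigenvalues with hν
  have hMV : M = V * diagonal (fun i => ((ν i : ℝ) : ℂ)) * Vᴴ := by
    rw [← star_eq_conjTranspose]; exact hMpsd.isHermitian.spectral_theorem
  obtain ⟨eq, heq⟩ : ∃ e : Fin (Fintype.card (m × n)) ≃ (m × n),
      ∀ i, hMpsd.isHermitian.eigenvalues (e i) = hMpsd.isHermitian.eigenvalues₀ i :=
    ⟨Fintype.equivOfCardEq (Fintype.card_fin _), fun i => by simp [Matrix.IsHermitian.eigenvalues]⟩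
  set S : Finset (m × n) := univ.filter (fun i : m × n => ((eq.symm i : Fin _) : ℕ) < k) with hS
  set Pk : Matrix (m × n) (m × n) ℂ := V * diagonal (fun j => if j ∈ S then (1 : ℂ) else 0) * Vᴴ with hPk
  have hPkh : Pkᴴ = Pk := frameProj_conjTranspose S
  have hPkPk : Pk * Pk = Pk := frameProj_mul_self S hVmem
  have hPktr : Pk.trace = (S.card : ℂ) := trace_frameProj S hVmem
  -- `Σ_{j<k} λ↓_j(M) = Tr(Pk M)`
  have hsumS : (∑ i ∈ univ.filter (fun i : Fin (Fintype.card (m × n)) => (i : ℕ) < k),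
      hMpsd.isHermitian.eigenvalues₀ i : ℝ) = ∑ i ∈ S, ν i :=
    Finset.sum_equiv eq (fun i => by simp [hS]) (fun i _ => (heq i).symm)
  have hTrPkM : (Pk * M).trace = (((∑ i ∈ S, ν i : ℝ)) : ℂ) := by
    rw [hPk, hMV, trace_frameProj_mul_frameDiag S hVmem, Complex.ofReal_sum]
  have hcardS : (S.card : ℝ) ≤ k := by
    have h1 : S.card = (univ.filter (fun i : Fin (Fintype.card (m × n)) => (i : ℕ) < k)).card :=
      (Finset.card_equiv eq fun i => by simp [hS]).symm
    rw [h1, card_filter_lt]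
    exact_mod_cast min_le_left _ _
  -- `G = √K Pk √K`, `0 ≤ G`, `K − G ⪰ 0`, `Tr G = Tr(Pk K) ≤ Tr Pk ≤ k`
  set G : Matrix (m × n) (m × n) ℂ := Q * Pk * Q with hG
  have hGpsd : G.PosSemidef := by
    have hPkpsd : Pk.PosSemidef := by
      have h := posSemidef_conjTranspose_mul_self Pk
      rwa [hPkh, hPkPk] at h
    have h := hPkpsd.mul_mul_conjTranspose_same Q
    rwa [hQh] at h
  have hKG : (K - G).PosSemidef := by
    -- `K − G = √K (1 − Pk) √K = (√K(1−Pk))(√K(1−Pk))^*`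
    have h1Pk : (1 - Pk) * (1 - Pk)ᴴ = 1 - Pk := by
      rw [conjTranspose_sub, conjTranspose_one, hPkh, Matrix.sub_mul, Matrix.mul_sub, Matrix.mul_sub, Matrix.one_mul,
        Matrix.mul_one, Matrix.one_mul, hPkPk]; abel
    have e : K - G = (Q * (1 - Pk)) * (Q * (1 - Pk))ᴴ := by
      rw [conjTranspose_mul, hQh, Matrix.mul_assoc, ← Matrix.mul_assoc (1 - Pk), h1Pk, Matrix.sub_mul,
        Matrix.one_mul, Matrix.mul_sub, hQQ, ← Matrix.mul_assoc]
    rw [e]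
    exact posSemidef_self_mul_conjTranspose _
  have hTrG : (G.trace).re ≤ k := by
    have h1 : G.trace = (Pk * K).trace := by
      rw [hG, Matrix.mul_assoc, trace_mul_comm, Matrix.mul_assoc, hQQ]
    have h2 : ((Pk * K).trace).re ≤ ((Pk * 1).trace).re := re_trace_proj_mul_le hPkh hPkPk hIK
    rw [Matrix.mul_one, hPktr, Complex.natCast_re] at h2
    rw [h1]
    exact h2.trans hcardS
  -- the weights `T_a = Tr(G (E_a ⊗ I))`
  set T : m → ℝ := fun a => ((G * (E a ⊗ₖ (1 : Matrix n n ℂ))).trace).re with hT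
  have hEt_h : ∀ a, (E a ⊗ₖ (1 : Matrix n n ℂ))ᴴ = E a ⊗ₖ 1 := fun a => by
    rw [conjTranspose_kronecker, hEh, conjTranspose_one]
  have hEt_sq : ∀ a, (E a ⊗ₖ (1 : Matrix n n ℂ)) * (E a ⊗ₖ 1) = E a ⊗ₖ 1 := fun a => by
    rw [← mul_kronecker_mul, hEE, if_pos rfl, Matrix.mul_one]
  have hT0 : ∀ a, 0 ≤ T a := fun a => by
    have h := trace_proj_mul_nonneg (hEt_h a) (hEt_sq a) hGpsd
    rw [trace_mul_comm] at h
    exact (Complex.nonneg_iff.1 h).1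
  -- `Tr(K (E_a ⊗ I)) = μ_a/(μ_a+ε)`
  have hKE : ∀ a, ((K * (E a ⊗ₖ (1 : Matrix n n ℂ))).trace).re = r a * r a * μ a := fun a => by
    have e1 : (K * (E a ⊗ₖ (1 : Matrix n n ℂ))).trace = (ρ * (Rt * (E a ⊗ₖ 1) * Rt)).trace := by
      rw [hK]
      simp only [Matrix.mul_assoc]
      rw [trace_mul_comm]
      simp only [Matrix.mul_assoc]
    have e2 : Rt * (E a ⊗ₖ (1 : Matrix n n ℂ)) * Rt = (((r a * r a : ℝ)) : ℂ) • (E a ⊗ₖ 1) := by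
      rw [hRt, ← mul_kronecker_mul, ← mul_kronecker_mul, hRER, Matrix.mul_one, Matrix.mul_one, smul_kronecker]
    have e3 : (ρ * (E a ⊗ₖ (1 : Matrix n n ℂ))).trace = (A * E a).trace := by
      rw [trace_mul_comm, trace_mul_comm A, hAdef, trace_mul_traceRight]
      congr 2
      ext ⟨x, y⟩ ⟨x', y'⟩
      simp only [kroneckerMap_apply, of_apply, one_apply, mul_ite, mul_one, mul_zero]
    have e4 : (A * E a).trace = ((μ a : ℝ) : ℂ) := by
      rw [hAE, hSummulE, trace_smul, hEtr, smul_eq_mul, mul_one]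
    rw [e1, e2, Matrix.mul_smul, trace_smul, e3, e4, smul_eq_mul, ← Complex.ofReal_mul, Complex.ofReal_re]
  have hT1 : ∀ a, T a ≤ r a * r a * μ a := fun a => by
    have h := re_trace_proj_mul_le (hEt_h a) (hEt_sq a) hKG
    rw [trace_mul_comm (E a ⊗ₖ 1) G, trace_mul_comm (E a ⊗ₖ 1) K, hKE] at h
    exact h
  have hT1' : ∀ a, T a ≤ 1 := fun a => (hT1 a).trans (by
    have := hrr a
    nlinarith [hμ0 a, hε, mul_self_nonneg (r a)])
  have hTsum : ∑ a, T a ≤ k := by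
    have h : ∑ a, T a = (G.trace).re := by
      rw [hT, ← Complex.re_sum, ← trace_sum, ← Finset.mul_sum,
        Literature.InformationTheory.Entanglement.Nielsen.kronecker_sum_left, hE1, one_kronecker_one, Matrix.mul_one]
    rw [h]; exact hTrG
  -- `Tr(Pk M) = Tr(G B_ε) = Σ_a (μ_a + ε) T_a`
  have hmain : (∑ i ∈ S, ν i : ℝ) = ∑ a, (μ a + ε) * T a := by
    have e1 : (Pk * M).trace = (G * Bε).trace := by
      rw [hM, hG, ← Matrix.mul_assoc, ← Matrix.mul_assoc, trace_mul_comm]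
      simp only [Matrix.mul_assoc]
    have e2 : Bε = ∑ a, (((μ a + ε : ℝ)) : ℂ) • (E a ⊗ₖ (1 : Matrix n n ℂ)) := by
      rw [hBε, hAε, ← Literature.InformationTheory.Entanglement.Nielsen.kronecker_sum_left]
      exact sum_congr rfl fun a _ => by rw [smul_kronecker]
    have e3 : ((G * Bε).trace).re = ∑ a, (μ a + ε) * T a := by
      rw [e2, Finset.mul_sum, trace_sum, Complex.re_sum]
      exact sum_congr rfl fun a _ => by rw [Matrix.mul_smul, trace_smul, smul_eq_mul, Complex.re_ofReal_mul]
    have h := congrArg Complex.re hTrPkM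
    rw [Complex.ofReal_re, e1, e3] at h
    exact h.symm
  -- the greedy step in the sorted eigenvalues `μ↓ = λ↓(ρ_A)` of `ρ_A`
  obtain ⟨em, hem⟩ : ∃ e : Fin (Fintype.card m) ≃ m,
      ∀ j, hA.isHermitian.eigenvalues (e j) = hA.isHermitian.eigenvalues₀ j :=
    ⟨Fintype.equivOfCardEq (Fintype.card_fin _), fun j => by simp [Matrix.IsHermitian.eigenvalues]⟩
  have hgreedy : ∑ a, μ a * T a ≤
      ∑ j ∈ univ.filter (fun j : Fin (Fintype.card m) => (j : ℕ) < k), hA.isHermitian.eigenvalues₀ j := by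
    have h1 : ∑ a, μ a * T a = ∑ j, hA.isHermitian.eigenvalues₀ j * T (em j) := by
      rw [← Equiv.sum_comp em]
      exact sum_congr rfl fun j _ => by rw [← hem j]
    rw [h1]
    refine sum_mul_le_sum_filter_of_sum_le _ _ hA.isHermitian.eigenvalues₀_antitone
      (fun j => ?_) (fun j => hT0 _) (fun j => hT1' _) ?_
    · rw [← hem j]; exact hμ0 (em j)
    · rw [Equiv.sum_comp em (fun a => T a)]; exact hTsum
  -- assemble
  have hRHS : ∑ j ∈ range k, (Matrix.toEuclideanLin (traceRight ρ)).singularValues j =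
      ∑ j ∈ univ.filter (fun j : Fin (Fintype.card m) => (j : ℕ) < k), hA.isHermitian.eigenvalues₀ j :=
    sum_singularValues_eq_sum_eigenvalues₀_of_posSemidef hA k
  rw [hRHS, hsumS, hmain]
  calc ∑ a, (μ a + ε) * T a = ∑ a, μ a * T a + ε * ∑ a, T a := by
        rw [Finset.mul_sum, ← sum_add_distrib]; exact sum_congr rfl fun a _ => by ring
    _ ≤ ∑ j ∈ univ.filter (fun j : Fin (Fintype.card m) => (j : ℕ) < k), hA.isHermitian.eigenvalues₀ j + ε * k :=
        add_le_add hgreedy (mul_le_mul_of_nonneg_left hTsum hε.le)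
    _ ≤ _ := by rw [mul_comm]; exact add_le_add le_rfl hkε

omit [DecidableEq m] [DecidableEq n] [Fintype m] in
/-- The lane's two partial traces agree: `PPT.trB = QuantumMarginals.traceRight`. [folklore] -/
private theorem trB_eq_traceRight (ρ : Matrix (m × n) (m × n) ℂ) : trB ρ = traceRight ρ := by
  ext i j
  rw [Literature.InformationTheory.Entanglement.PPT.trB_apply, traceRight_apply]

/-- **Theorem 1 in the vocabulary of the lane's reduction criterion** (`WernerStateSeparability.lean`, B&Ż B3 /
Bertlmann–Friis (15.102): `redB ρ = ρ_A ⊗ 𝟙 − ρ`): `(𝟙 ⊗ Λ)ρ ⪰ 0 ⟹ λ(ρ) ≺_w λ(ρ_A)`.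
[cite: Hiroshima2003, Thm 1] [cite: BengtssonZyczkowski2017, § 16.6 B3 (16.65), B4 (16.67)] -/
theorem sum_singularValues_le_traceRight_of_redB {ρ : Matrix (m × n) (m × n) ℂ} (hρ : ρ.PosSemidef)
    (hred : (redB ρ).PosSemidef) (k : ℕ) :
    ∑ j ∈ range k, (Matrix.toEuclideanLin ρ).singularValues j ≤
      ∑ j ∈ range k, (Matrix.toEuclideanLin (traceRight ρ)).singularValues j := by
  rw [Literature.InformationTheory.Entanglement.PPT.redB_apply, trB_eq_traceRight] at hred
  exact sum_singularValues_le_traceRight_of_reduction hρ hred k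

/-- The equality clause of `λ(ρ_{AB}) ≺ λ(ρ_A)`: once all (padded) eigenvalues are summed, both sides equal
`Tr ρ_{AB} = Tr ρ_A` («the obvious fact that `Tr_{AB} ρ_{AB} = Tr_A ρ_A`»). [cite: Hiroshima2003, proof of Thm 1 (last
step)] -/
theorem sum_singularValues_eq_sum_singularValues_traceRight {ρ : Matrix (m × n) (m × n) ℂ} (hρ : ρ.PosSemidef)
    {k : ℕ} (hk : Fintype.card (m × n) ≤ k) (hk' : Fintype.card m ≤ k) :
    ∑ j ∈ range k, (Matrix.toEuclideanLin ρ).singularValues j =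
      ∑ j ∈ range k, (Matrix.toEuclideanLin (traceRight ρ)).singularValues j := by
  have hA : (traceRight ρ).PosSemidef := posSemidef_traceRight hρ
  have h1 := (Literature.LinearAlgebra.Matrix.EigenvalueSingularValueSumEqualityCases.re_trace_eq_sum_singularValues_iff_posSemidef
    ρ).2 hρ
  have h2 := (Literature.LinearAlgebra.Matrix.EigenvalueSingularValueSumEqualityCases.re_trace_eq_sum_singularValues_iff_posSemidef
    (traceRight ρ)).2 hA
  rw [← Finset.sum_subset (Finset.range_subset_range.2 hk) fun j _ hj =>
      singularValues_toEuclideanLin_of_card_le ρ (not_lt.1 fun h' => hj (mem_range.2 h')),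
    ← Finset.sum_subset (Finset.range_subset_range.2 hk') fun j _ hj =>
      singularValues_toEuclideanLin_of_card_le (traceRight ρ) (not_lt.1 fun h' => hj (mem_range.2 h')),
    ← h1, ← h2, trace_traceRight]

omit [DecidableEq m] [DecidableEq n] in
/-- A trace-one operator on `ℂ^m ⊗ ℂ^n` forces `n ≠ ∅`, so `dim ρ_A ≤ dim ρ`. [folklore] -/
private theorem card_le_card_prod_of_trace_eq_one {ρ : Matrix (m × n) (m × n) ℂ} (hρ1 : ρ.trace = 1) :
    Fintype.card m ≤ Fintype.card (m × n) := by
  have hmn : 0 < Fintype.card (m × n) := by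
    by_contra h0
    have : IsEmpty (m × n) := Fintype.card_eq_zero_iff.1 (Nat.le_zero.1 (not_lt.1 h0))
    rw [Matrix.trace, Fintype.sum_empty] at hρ1
    exact zero_ne_one hρ1
  rw [Fintype.card_prod] at hmn ⊢
  exact Nat.le_mul_of_pos_right _ (Nat.pos_of_mul_pos_left hmn)

end Theorem1

/-! ## § 3. Consequences: the reduction criterion implies the entropy criterion -/

section Entropy

variable {m n : Type*} [Fintype m] [Fintype n] [DecidableEq m] [DecidableEq n]

/-- **B3 ⟹ B5 at `q = 1`: a state with `ρ_A ⊗ I ≥ ρ` has `S(ρ_A) ≤ S(ρ)`** (Theorem 1 and «`λ(ρ) ≺ λ(σ)` implies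
`S(ρ) ≥ S(σ)`», the tree's `vonNeumannEntropy_le_of_majorized`). [cite: Hiroshima2003, Thm 1] [cite: NielsenKempe2001,
after Thm 1] -/
theorem vonNeumannEntropy_traceRight_le_of_reduction {ρ : Matrix (m × n) (m × n) ℂ} (hρ : ρ.PosSemidef)
    (hρ1 : ρ.trace = 1) (hred : (traceRight ρ ⊗ₖ (1 : Matrix n n ℂ) - ρ).PosSemidef) :
    vonNeumannEntropy (traceRight ρ) ≤ vonNeumannEntropy ρ :=
  vonNeumannEntropy_le_of_majorized hρ hρ1 (posSemidef_traceRight hρ) (by rw [trace_traceRight, hρ1])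
    (card_le_card_prod_of_trace_eq_one hρ1) (sum_singularValues_le_traceRight_of_reduction hρ hred)

/-- **B3 ⟹ B5: a state with `ρ_A ⊗ I ≥ ρ` has `S_q(ρ_A) ≤ S_q(ρ)` for every `q ≥ 0`** (Theorem 1 and Schur
concavity, the tree's `renyiEntropy_le_of_majorized`). [cite: Hiroshima2003, Thm 1] [cite: BengtssonZyczkowski2017,
§ 16.6 B4–B5 (16.67)–(16.68)] -/
theorem renyiEntropy_traceRight_le_of_reduction {ρ : Matrix (m × n) (m × n) ℂ} (hρ : ρ.PosSemidef)
    (hρ1 : ρ.trace = 1) (hred : (traceRight ρ ⊗ₖ (1 : Matrix n n ℂ) - ρ).PosSemidef) {q : ℝ} (hq : 0 ≤ q) :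
    renyiEntropy q (traceRight ρ) ≤ renyiEntropy q ρ :=
  renyiEntropy_le_of_majorized hρ hρ1 (posSemidef_traceRight hρ) (by rw [trace_traceRight, hρ1])
    (card_le_card_prod_of_trace_eq_one hρ1) (sum_singularValues_le_traceRight_of_reduction hρ hred) hq

end Entropy

end Literature.InformationTheory.Entanglement.ReductionCriterionMajorization
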